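import Summits.ResolutionOfSingularities.ResolutionOfSingularities.Theorems.PurelyInseparableDim4ResConeVertexDrop
import HarnessLib
import HarnessLib.Audit.Tags

/-!
# Purely inseparable four-folds — K2(p) REDUCES TO THE CONSTANT-`(d, e_G)` TRAPS WITH `e_G ≥ 2`
# (idea-4 I-4-6 (VT)(iii) monotonicity + the `e_G ≤ 1` closure of FILE 3c), every prime

[OURS · counted 0 · cell `res-dim4-pi` · desk WORD #55 (a) / crit-4 g2 V-A4-13 · seat res-dim4-p-12 g2.]
Nothing here proves K2(p), `NoIsolatedTrap p p` or resolution of singularities in dimension ≥ 4 /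
characteristic `p`.

Along an isolated above-floor `Step0 p` chain with `x^{r₀} ∣ F₀` and CONSTANT shade (the form K2(p) takes by
`BandShade.noAboveFloorTrap_iff_noConstantShadeTrap`), every step keeps the shade, so by (VT)(iii)
(`finrank_resVertex_step_le`) the polar-kernel rank `e_G(c_k) = finrank (resVertex (c k))` is antitone, hence
eventually constant `= e`; the value `e ≤ 1` is excluded by FILE 3c (`no_isolated_chain_eventually_vertex_le_one`,
free-tail lemma).  Hence:

* `finrank_resVertex_succ_le`, `finrank_resVertex_eventually_const`;
* **`noAboveFloorTrap_iff_noConstantVertexTrap`** — `K2(p) = NoAboveFloorTrap p p` holds iff there is no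
  isolated above-floor `Step0 p` chain with `x^{r₀} ∣ F₀`, constant shade `d` and constant polar-kernel rank
  `e_G ≡ e ≥ 2`.  THE REMAINING OPEN CASES OF K2(p) are therefore `e ∈ {2, 3, 4}` (numbers, not a proof).
bears_on: LADDER-RESOLUTION:D157-DOOR2 (res-dim4-pi · K2(p)).  Supports stmt-ResolutionOfSingularities-16155
(helper).
-/

set_option linter.dupNamespace false -- mandated namespace of this single-conjunct summit

noncomputable section

namespace Summit.ResolutionOfSingularities.ResolutionOfSingularities.Theorems.PIDim4

namespace ResCone

open MvPolynomial Finset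
open Literature.AlgebraicGeometry.Resolution
open Literature.AlgebraicGeometry.Resolution.CentreBlowup
open Literature.AlgebraicGeometry.Resolution.Hauser2010
open Literature.AlgebraicGeometry.Resolution.HauserPerlega2019
open PointBlowup (polarMap additiveSubspace direction)

variable {K : Type} [Field K]

/-- **`e_G` is antitone along a constant-shade isolated above-floor chain with `x^{r₀} ∣ F₀`** (every
prime; (VT)(iii) step by step). [OURS] [cite: CossartJannsenSaito2020, Thm. 3.10(4), Thm. 9.3] -/
theorem finrank_resVertex_succ_le (p : ℕ) [Fact p.Prime] [DecidableEq K] {c : ℕ → State K}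
    (hc : ∀ k, IsIsolated p (c k).F ∧ Step0 p (c k) (c (k + 1)))
    (hr0 : ∀ e ∈ (c 0).F.support, (c 0).r ≤ e) (hfloor : ∀ k, ordZero (c k).F ≠ p) {d : ℕ∞}
    (hshade : ∀ k, (c k).shade = d) (k : ℕ) :
    Module.finrank K (resVertex (c (k + 1))) ≤ Module.finrank K (resVertex (c k)) := by
  obtain ⟨j, b, hw⟩ := FreeTail.exists_witnesses (K := K) (fun k => (hc k).2)
  obtain ⟨o, ho, hpo, ho2⟩ := BandShade.exists_ordZero_eq p hc k
  have hpo' : p < o := lt_of_le_of_ne hpo (fun h => hfloor k (by rw [ho, h]))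
  have ho2' : o < 2 * p := by
    have hp : 2 ≤ p := (Fact.out : p.Prime).two_le
    omega
  obtain ⟨-, hbk, -, -, hck⟩ := hw k
  have heq : (CentreBlowup.step p Finset.univ (j k) (b k) (c k)).shade = (c k).shade := by
    rw [← hck, hshade, hshade]
  rw [hck]
  exact finrank_resVertex_step_le (j k) hbk ho (IsolatedBand.isolated_chain_forall_le hc hr0 k) hpo'
    ho2' heq

/-- Hence `e_G` is eventually constant along such a chain. [OURS] [folklore] -/
theorem finrank_resVertex_eventually_const (p : ℕ) [Fact p.Prime] [DecidableEq K] {c : ℕ → State K}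
    (hc : ∀ k, IsIsolated p (c k).F ∧ Step0 p (c k) (c (k + 1)))
    (hr0 : ∀ e ∈ (c 0).F.support, (c 0).r ≤ e) (hfloor : ∀ k, ordZero (c k).F ≠ p) {d : ℕ∞}
    (hshade : ∀ k, (c k).shade = d) :
    ∃ M e : ℕ, ∀ k, M ≤ k → Module.finrank K (resVertex (c k)) = e := by
  obtain ⟨M, hM⟩ := Directrix.exists_eventually_const_of_antitone
    (fun k => Module.finrank K (resVertex (c k)))
    (antitone_nat_of_succ_le fun k => finrank_resVertex_succ_le p hc hr0 hfloor hshade k)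
  exact ⟨M, _, hM⟩

/-- **K2(p) ⟺ NO CONSTANT-`(d, e_G)` TRAP WITH `e_G ≥ 2`** (every prime `p`): `RidgeBudget.NoAboveFloorTrap p p`
holds iff over every field of characteristic `p` there is no isolated above-floor `Step0 p` chain with
`x^{r₀} ∣ F₀`, constant shade and constant polar-kernel rank `e ≥ 2`.  (`→` forgets; `←`: re-zero and make
the shade constant by `BandShade`, make `e_G` constant by antitonicity, discard `e ≤ 1` by FILE 3c.)
[OURS] [cite: CossartJannsenSaito2020, Thm. 3.14] -/
theorem noAboveFloorTrap_iff_noConstantVertexTrap (p : ℕ) [Fact p.Prime] :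
    RidgeBudget.NoAboveFloorTrap p p ↔ ∀ (K : Type) [Field K] [CharP K p] [DecidableEq K],
      ¬ ∃ (c : ℕ → State K) (d : ℕ∞) (e : ℕ), 2 ≤ e ∧ (∀ e' ∈ (c 0).F.support, (c 0).r ≤ e') ∧
        ∀ k, IsIsolated p (c k).F ∧ Step0 p (c k) (c (k + 1)) ∧ ordZero (c k).F ≠ p ∧
          (c k).shade = d ∧ Module.finrank K (resVertex (c k)) = e := by
  constructor
  · intro h K _ _ _
    rintro ⟨c, d, e, -, -, hc⟩
    exact h K ⟨c, fun k => ⟨(hc k).1, (hc k).2.1, (hc k).2.2.1⟩⟩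
  · intro h
    rw [BandShade.noAboveFloorTrap_iff_noConstantShadeTrap]
    intro K _ _ _
    rintro ⟨c, d, hr0, hc⟩
    have hc2 : ∀ k, IsIsolated p (c k).F ∧ Step0 p (c k) (c (k + 1)) := fun k => ⟨(hc k).1, (hc k).2.1⟩
    have hfloor : ∀ k, ordZero (c k).F ≠ p := fun k => (hc k).2.2.1
    have hshade : ∀ k, (c k).shade = d := fun k => (hc k).2.2.2
    obtain ⟨M, e, hM⟩ := finrank_resVertex_eventually_const p hc2 hr0 hfloor hshade
    by_cases he : e ≤ 1
    · exact no_isolated_chain_eventually_vertex_le_one p hc2 hr0 hfloor (k₀ := M) (d := d)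
        (fun k _ => hshade k) (fun k hk => (hM k hk).le.trans he)
    · refine h K ⟨fun k => c (M + k), d, e, by omega, IsolatedBand.isolated_chain_forall_le hc2 hr0 M,
        fun k => ⟨(hc (M + k)).1, ?_, hfloor (M + k), hshade (M + k), hM (M + k) (by omega)⟩⟩
      exact (hc (M + k)).2.1

/-- **The open residue of K2(p), named**: «no constant-`(d, e_G)` trap with `e_G ≥ 2`» implies K2(p).
[OURS] -/
theorem noAboveFloorTrap_of_noConstantVertexTrap (p : ℕ) [Fact p.Prime]
    (h : ∀ (K : Type) [Field K] [CharP K p] [DecidableEq K],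
      ¬ ∃ (c : ℕ → State K) (d : ℕ∞) (e : ℕ), 2 ≤ e ∧ (∀ e' ∈ (c 0).F.support, (c 0).r ≤ e') ∧
        ∀ k, IsIsolated p (c k).F ∧ Step0 p (c k) (c (k + 1)) ∧ ordZero (c k).F ≠ p ∧
          (c k).shade = d ∧ Module.finrank K (resVertex (c k)) = e) :
    RidgeBudget.NoAboveFloorTrap p p :=
  (noAboveFloorTrap_iff_noConstantVertexTrap p).mpr h

end ResCone

end Summit.ResolutionOfSingularities.ResolutionOfSingularities.Theorems.PIDim4

end
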